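import Literature.Probability.Percolation.TriUQuadFences
import Literature.Probability.Percolation.TriUQuadCorridor
import HarnessLib

/-!
# From a fenced tip and its corridor to a real point, for every tip position

Topic `Literature/Probability/Percolation`; family `crit-perc`, statement **crit-perc.S16**
(`Literature.Probability.Percolation.triTheta_exponent`). The deterministic synthesis of the fence
step (`TriUQuadFences.lean`) and the corridor step (`TriUQuadCorridor.lean`) of Kesten's arm
separation in the U-shaped half-plane region, in P. Nolin's form (EJP 13 (2008), §4.2 Def. 6,
§4.3 Lemma 12, §4.4 proof of Lemma 15, §4.5 proof of Prop. 17 [arXiv 0711.4948: Def. 6,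
Lemma 11, Lemma 14, Prop. 16]): in the abstract setting of an inner–outer crossing `S ⊆ U ∩ χ`
with tip `l`, examined set `P₀ ⊆ uLow S ∪ S`, a frame of scale `M` about `l` open in the forced
configuration, and the **corridor of the tip** `corrOf s W A' l f` (chosen by the side of the arc
carrying `l` and the foot `f`), there is a real point `x` — on the floor of the inner half-box, or
on the right real segment just outside it — joined to a site of `S` by a `χ`-open path of `U ∪ I`.

* `corrOf s W A' l f` — the corridor event of a tip (`f = true`: right foot).
* `realPoint_of_frame_corridor` — the synthesis, by cases: top side (`uFence_topR` /
  `uFence_topL`), left side (`uFence_leftN` / `uFence_leftS`), right side (`uFence_rightS`, or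
  `uPoint_rightB` near the real line, where no corridor is needed).

## References

* P. Nolin, Near-critical percolation in two dimensions, *Electron. J. Probab.* 13 (2008), §4.2
  Def. 6, §4.3 Lemma 12, §4.4 proof of Lemma 15, §4.5 proof of Prop. 17 [arXiv 0711.4948: Def. 6,
  Lemma 11, Lemma 14, Prop. 16] [Nolin2008].
* H. Kesten, Scaling relations for 2D-percolation, *Comm. Math. Phys.* 109 (1987), Lemmas 2, 4
  [KestenScalingCMP1987].

## Mathlib / tree

Tree: `uFence_topR`, `uFence_topL`, `uFence_leftN`, `uFence_leftS`, `uFence_rightS`,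
`uPoint_rightB` (`TriUQuadFences.lean`), `corrTopRight`, …, `realPoint_of_fenceV_topRight`, …
(`TriUQuadCorridor.lean`), `FrameData`, `mem_uL_iff`.
-/

noncomputable section

open Set

namespace Literature.Probability.Percolation

open LatticeModels

/-- **The corridor of a tip** `l` of the inner arc of `U_{s,·}` with foot `f` (`true` = the right
real segment of the inner half-box, `false` = the left one), band width `W`, port margin `A'`:
for a tip on the top side, the top band from/to a port at horizontal distance `A'` and the leg on
the side of the foot; for a tip on a lateral side, the leg below a port at vertical distance `A'`
(same side as the foot) or the way around (up from the port, along the top, down the other leg). [cite: Nolin2008, §4.5, proof of Prop. 17 (arXiv 0711.4948: Prop. 16)] -/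
def corrOf (s W A' : ℕ) (l : Site 2) (f : Bool) : Set (Set (Site 2)) :=
  if l 1 = s then
    (if f then corrTopRight s W (max (-(s : ℤ) + 1) (l 0 - A')) else corrTopLeft s W (min ((s : ℤ) - 1) (l 0 + A')))
  else if l 0 = -(s : ℤ) then
    (if f then corrAroundLeft s W (max 0 (l 1 - A')) else corrLegLeft s W (min ((s : ℤ) - W - 1) (l 1 + A')))
  else
    (if f then corrLegRight s W (min ((s : ℤ) - W - 1) (l 1 + A')) else corrAroundRight s W (max 0 (l 1 - A')))

section Synthesis

variable {s Nq W A M : ℕ} {S P₀ χ : Set (Site 2)} {l y : Site 2}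

/-- **Fenced tip + corridor ⇒ a real point joined to the crossing.** Quad `U_{s,Nq}`, crossing
support `S ⊆ U ∩ χ` from `l ∈ uL` to `y ∈ uR` meeting the arc only at `l`, examined set
`P₀ ⊆ uLow S ∪ S`, a frame of scale `M` (`W ≤ M`, `2M ≤ A`) about `l` open in
`χ ∪ (P₀ ∪ (U ∪ I)ᶜ)`, and the corridor `corrOf s W (A + W) l f` realised by `χ`. Then some real
point `x` with `-s + 1 ≤ x₀ ≤ s + 2M` is joined to a site of `S` by a `χ`-open path of `U ∪ I`
(`2 ≤ W`, `4A + 2W + 8 ≤ s`, `s + A ≤ Nq`). [cite: Nolin2008, §4.2 Def. 6, §4.4 proof of Lemma 15, §4.5 proof of Prop. 17 (arXiv 0711.4948: Def. 6, Lemma 14, Prop. 16)] [cite: KestenScalingCMP1987, Lemmas 2 and 4] -/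
theorem realPoint_of_frame_corridor (hs : 1 ≤ s) (hsN : s + 1 ≤ Nq) (hSU : S ⊆ ↑(uSites s Nq))
    (hSχ : S ⊆ χ) (hP₀ : P₀ ⊆ uLow s Nq S ∪ S) (honly : ∀ z ∈ S, z ∈ uL s Nq → z = l)
    (hl : l ∈ uL s Nq) (hy : y ∈ uR s Nq) (hpγ : PathIn triGraph S l y)
    (hW : 2 ≤ W) (hWM : W ≤ M) (hMA : 2 * M ≤ A) (hsA : 4 * A + 2 * W + 8 ≤ s) (hNq : s + A ≤ Nq)
    (F : FrameData l M (χ ∪ (P₀ ∪ ((↑(uSites s Nq) : Set (Site 2)) ∪ uInner s)ᶜ))) {f : Bool}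
    (hcorr : χ ∈ corrOf s W (A + W) l f) :
    ∃ x : Site 2, x 1 = 0 ∧ -(s : ℤ) + 1 ≤ x 0 ∧ x 0 ≤ s + 2 * M ∧
      ∃ g ∈ S, PathIn triGraph (χ ∩ (↑(uSites s Nq) ∪ uInner s)) x g := by
  have hs' : (1 : ℤ) ≤ s := by exact_mod_cast hs
  have hW' : (2 : ℤ) ≤ W := by exact_mod_cast hW
  have hWM' : (W : ℤ) ≤ M := by exact_mod_cast hWM
  have hMA' : 2 * (M : ℤ) ≤ A := by exact_mod_cast hMA
  have hsA' : 4 * (A : ℤ) + 2 * W + 8 ≤ s := by exact_mod_cast hsA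
  have hW1 : 1 ≤ W := le_trans (by norm_num) hW
  have hM1 : 1 ≤ M := hW1.trans hWM
  have hM2 : 2 ≤ M := hW.trans hWM
  have hWk : 2 * W + 1 ≤ s := by omega
  have hMN : s + 2 * M ≤ Nq := by omega
  have hlL := (mem_uL_iff hs hsN).1 hl
  -- shrink the window of the conclusion
  have widen : ∀ {x : Site 2}, x 1 = 0 → -(s : ℤ) + 1 ≤ x 0 → x 0 ≤ (s : ℤ) - 1 →
      (∃ g ∈ S, PathIn triGraph (χ ∩ (↑(uSites s Nq) ∪ uInner s)) x g) →
      ∃ x : Site 2, x 1 = 0 ∧ -(s : ℤ) + 1 ≤ x 0 ∧ x 0 ≤ s + 2 * M ∧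
        ∃ g ∈ S, PathIn triGraph (χ ∩ (↑(uSites s Nq) ∪ uInner s)) x g :=
    fun h1 h2 h3 h4 => ⟨_, h1, h2, by omega, h4⟩
  -- `max` / `min` bookkeeping for the ports
  have pmax : ∀ a b : ℤ, a ≤ max a b ∧ b ≤ max a b ∧ (max a b = a ∨ max a b = b) :=
    fun a b => ⟨le_max_left a b, le_max_right a b, max_choice a b⟩
  have pmin : ∀ a b : ℤ, min a b ≤ a ∧ min a b ≤ b ∧ (min a b = a ∨ min a b = b) :=
    fun a b => ⟨min_le_left a b, min_le_right a b, min_choice a b⟩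
  by_cases htop : l 1 = s
  · -- ### tip on the top side
    have hc : corrOf s W (A + W) l f = (if f then corrTopRight s W (max (-(s : ℤ) + 1) (l 0 - ↑(A + W)))
        else corrTopLeft s W (min ((s : ℤ) - 1) (l 0 + ↑(A + W)))) := by
      simp only [corrOf, htop, if_true]
    rw [hc] at hcorr
    push_cast at hcorr
    have hl0 : -(s : ℤ) ≤ l 0 ∧ l 0 ≤ (s : ℤ) - 1 := by omega
    obtain ⟨m1, m2, m3⟩ := pmax (-(s : ℤ) + 1) (l 0 - (A + W))
    obtain ⟨n1, n2, n3⟩ := pmin ((s : ℤ) - 1) (l 0 + (A + W))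
    by_cases hR : -(s : ℤ) + 1 ≤ l 0 - 2 * M
    · obtain ⟨X, a, b, hX, bX, hab, ha1, hb1, htight, hjoin⟩ :=
        uFence_topR hs hsN hSU hSχ hP₀ honly hl hy hpγ hM2 (by omega) hMN htop hR F
      cases f
      · simp only [Bool.false_eq_true, if_false] at hcorr
        obtain ⟨x, hx1, hx0, hx0', hg⟩ := realPoint_of_fenceV_topLeft (N := Nq) hW1 hWk (xe := min ((s : ℤ) - 1) (l 0 + (A + W)))
          (x₁ := l 0 - 2 * M) (x₂ := l 0 - M) (ρ := (s : ℤ) - 2 * M) n1 (by omega) (by omega) (by omega) (by omega)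
          (by omega) hX bX hab ha1 hb1 htight hjoin hcorr
        exact widen hx1 hx0 hx0' hg
      · simp only [if_true] at hcorr
        obtain ⟨x, hx1, hx0, hx0', hg⟩ := realPoint_of_fenceV_topRight (N := Nq) hW1 hWk (xs := max (-(s : ℤ) + 1) (l 0 - (A + W)))
          (x₁ := l 0 - 2 * M) (x₂ := l 0 - M) (ρ := (s : ℤ) - 2 * M) m1 (by omega) (by omega) (by omega) (by omega)
          (by omega) hX bX hab ha1 hb1 htight hjoin hcorr
        exact widen hx1 hx0 hx0' hg
    · push Not at hR
      obtain ⟨X, a, b, hX, bX, hab, ha1, hb1, htight, hjoin⟩ :=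
        uFence_topL hs hsN hSU hSχ hP₀ honly hl hy hpγ hM2 (by omega) hMN htop (by omega) F
      cases f
      · simp only [Bool.false_eq_true, if_false] at hcorr
        obtain ⟨x, hx1, hx0, hx0', hg⟩ := realPoint_of_fenceV_topLeft (N := Nq) hW1 hWk (xe := min ((s : ℤ) - 1) (l 0 + (A + W)))
          (x₁ := l 0 + M) (x₂ := l 0 + 2 * M) (ρ := (s : ℤ) - 2 * M) n1 (by omega) (by omega) (by omega) (by omega)
          (by omega) hX bX hab ha1 hb1 htight hjoin hcorr
        exact widen hx1 hx0 hx0' hg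
      · simp only [if_true] at hcorr
        obtain ⟨x, hx1, hx0, hx0', hg⟩ := realPoint_of_fenceV_topRight (N := Nq) hW1 hWk (xs := max (-(s : ℤ) + 1) (l 0 - (A + W)))
          (x₁ := l 0 + M) (x₂ := l 0 + 2 * M) (ρ := (s : ℤ) - 2 * M) m1 (by omega) (by omega) (by omega) (by omega)
          (by omega) hX bX hab ha1 hb1 htight hjoin hcorr
        exact widen hx1 hx0 hx0' hg
  by_cases hleft : l 0 = -(s : ℤ)
  · -- ### tip on the left side
    have hc : corrOf s W (A + W) l f = (if f then corrAroundLeft s W (max 0 (l 1 - ↑(A + W)))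
        else corrLegLeft s W (min ((s : ℤ) - W - 1) (l 1 + ↑(A + W)))) := by
      simp only [corrOf, htop, hleft, if_true, if_false]
    rw [hc] at hcorr
    push_cast at hcorr
    have ht : 0 ≤ l 1 ∧ l 1 ≤ (s : ℤ) - 1 := by omega
    obtain ⟨m1, m2, m3⟩ := pmax 0 (l 1 - (A + W))
    obtain ⟨n1, n2, n3⟩ := pmin ((s : ℤ) - W - 1) (l 1 + (A + W))
    by_cases hN : l 1 + 2 * M ≤ (s : ℤ) - W - 1
    · obtain ⟨X, a, b, hX, bX, hab, ha0, hb0, htight, hjoin⟩ :=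
        uFence_leftN hs hsN hSU hSχ hP₀ honly hl hy hpγ hM1 hMN hleft (by omega) F
      cases f
      · simp only [Bool.false_eq_true, if_false] at hcorr
        obtain ⟨x, hx1, hx0, hx0', hg⟩ := realPoint_of_fenceH_legLeft (N := Nq) hW1 hWk
          (re := min ((s : ℤ) - W - 1) (l 1 + (A + W))) (x₂ := -(s : ℤ) + 2 * M) (ρ₁ := l 1 + M) (ρ₂ := l 1 + 2 * M)
          (by omega) (by omega) (by omega) (by omega) (by omega) hX bX hab ha0 hb0 htight hjoin hcorr
        exact widen hx1 hx0 hx0' hg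
      · simp only [if_true] at hcorr
        obtain ⟨x, hx1, hx0, hx0', hg⟩ := realPoint_of_fenceH_aroundLeft (N := Nq) hW1 hWk
          (rs := max 0 (l 1 - (A + W))) (x₂ := -(s : ℤ) + 2 * M) (ρ₁ := l 1 + M) (ρ₂ := l 1 + 2 * M)
          m1 (by omega) (by omega) (by omega) (by omega) (by omega) hX bX hab ha0 hb0 htight hjoin hcorr
        exact widen hx1 hx0 hx0' hg
    · push Not at hN
      obtain ⟨X, a, b, hX, bX, hab, ha0, hb0, htight, hjoin⟩ :=
        uFence_leftS hs hsN hSU hSχ hP₀ honly hl hy hpγ hM1 hMN hleft (by omega) ht.2 F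
      cases f
      · simp only [Bool.false_eq_true, if_false] at hcorr
        obtain ⟨x, hx1, hx0, hx0', hg⟩ := realPoint_of_fenceH_legLeft (N := Nq) hW1 hWk
          (re := min ((s : ℤ) - W - 1) (l 1 + (A + W))) (x₂ := -(s : ℤ) + 2 * M) (ρ₁ := l 1 - 2 * M) (ρ₂ := l 1 - M)
          (by omega) (by omega) (by omega) (by omega) (by omega) hX bX hab ha0 hb0 htight hjoin hcorr
        exact widen hx1 hx0 hx0' hg
      · simp only [if_true] at hcorr
        obtain ⟨x, hx1, hx0, hx0', hg⟩ := realPoint_of_fenceH_aroundLeft (N := Nq) hW1 hWk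
          (rs := max 0 (l 1 - (A + W))) (x₂ := -(s : ℤ) + 2 * M) (ρ₁ := l 1 - 2 * M) (ρ₂ := l 1 - M)
          m1 (by omega) (by omega) (by omega) (by omega) (by omega) hX bX hab ha0 hb0 htight hjoin hcorr
        exact widen hx1 hx0 hx0' hg
  · -- ### tip on the right side
    have hright : l 0 = s := by omega
    have hc : corrOf s W (A + W) l f = (if f then corrLegRight s W (min ((s : ℤ) - W - 1) (l 1 + ↑(A + W)))
        else corrAroundRight s W (max 0 (l 1 - ↑(A + W)))) := by
      simp only [corrOf, htop, hleft, if_false]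
    rw [hc] at hcorr
    push_cast at hcorr
    have ht : 0 ≤ l 1 ∧ l 1 ≤ (s : ℤ) - 1 := by omega
    obtain ⟨m1, m2, m3⟩ := pmax 0 (l 1 - (A + W))
    obtain ⟨n1, n2, n3⟩ := pmin ((s : ℤ) - W - 1) (l 1 + (A + W))
    by_cases hB : l 1 < 2 * (M : ℤ)
    · -- near the real line: a real point of `T`, no corridor needed
      obtain ⟨x, hx1, hx0, hx0', hg⟩ := uPoint_rightB hs hsN hSU hSχ hP₀ honly hl hy hpγ hM1 hMN hright hB (by omega) F
      exact ⟨x, hx1, by omega, by omega, hg⟩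
    · push Not at hB
      obtain ⟨X, a, b, hX, bX, hab, ha0, hb0, htight, hjoin⟩ :=
        uFence_rightS hs hsN hSU hSχ hP₀ honly hl hy hpγ hM2 hMN hright hB F
      cases f
      · simp only [Bool.false_eq_true, if_false] at hcorr
        obtain ⟨x, hx1, hx0, hx0', hg⟩ := realPoint_of_fenceH_aroundRight (N := Nq) hW1 hWk
          (rs := max 0 (l 1 - (A + W))) (x₁ := (s : ℤ) - 2 * M) (ρ₁ := l 1 - 2 * M) (ρ₂ := l 1 - M)
          m1 (by omega) (by omega) (by omega) (by omega) (by omega) hX bX hab ha0 hb0 htight hjoin hcorr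
        exact widen hx1 hx0 hx0' hg
      · simp only [if_true] at hcorr
        obtain ⟨x, hx1, hx0, hx0', hg⟩ := realPoint_of_fenceH_legRight (N := Nq) hW1 hWk
          (re := min ((s : ℤ) - W - 1) (l 1 + (A + W))) (x₁ := (s : ℤ) - 2 * M) (ρ₁ := l 1 - 2 * M) (ρ₂ := l 1 - M)
          (by omega) (by omega) (by omega) (by omega) (by omega) hX bX hab ha0 hb0 htight hjoin hcorr
        exact widen hx1 hx0 hx0' hg

end Synthesis

end Literature.Probability.Percolation
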